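import Literature.Probability.Percolation.TrackExchangeTwoSided
import HarnessLib

/-!
# Transport of horizontal crossings through the regular block (GM14 Proposition 6.4) — I:
# the process of blocks and the growth comparison

Grimmett–Manolescu, *Bond percolation on isoradial graphs* (PTRF 159 (2014) 273–327 =
arXiv:1204.0505), §6.1–6.2: the isoradial square lattice `G = G_{α,β̃}` with
`β̃_j = ξ (j < N)`, `β̃_j = β_{j-N} (j ≥ N)` ("regular block" of height `N` below the "irregular
block"), the operators `U_k = Σ_k ∘ ⋯ ∘ Σ_{N+k-1}` (6.8) applied for `k = 1, 2, …`, the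
transported open path `γ^k = U_k ∘ ⋯ ∘ U_1(γ^0)` and its shifted column heights
`H^k_n = h(γ^k ∩ col_{n+d_k})` ("the term `d_k` is included to compensate for the asymmetric
lateral drift"), Lemma 6.6 (`H^{k+1}_n ≤ max{C(H^k)_n, H^k_n + Y^k_n}`) and the comparison
`H^k ≤ X^k` with the growth process (6.16) ("We show first, by induction, that `X^k ≥ H^k` for
all `k`").

This file assembles the pathwise part on the strip:

* `HData` — `M, α, β, ξ, N` and the number `K` of blocks; `HData.rowAngle k` (row angles after
  `k` blocks), `HData.weights k` (the canonical weights of the strip at that time),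
  `HData.Bk k : BlockData` (the `k`-th block, `TrackExchangeBlock`), with
  `Bk_initial`/`Bk_final`: its initial weights are `weights k`, its final ones `weights (k+1)`;
  blocks with `β_k = ξ` are skipped (`blockStep`), as in GM14 ("If `β_k = ξ`, no track
  exchange takes place"); blocks with `β_k > ξ` sweep from left to right (`BlockData.blockW`),
  blocks with `β_k < ξ` from right to left (`BlockData.blockWRL`, the conjugate by the
  reflection of the strip, `TrackExchangeTwoSided`).
* measurability of the pathwise maps on (configuration, walk) pairs, for the discrete σ-algebra
  on walks (`measurable_moveStepW`, …, `measurable_blockStep`).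
* `HData.traj` — the states `(ω^k, γ^k)` after `k` blocks; `HData.ProcInv` (clean, open,
  pinned endpoints, primal, in the tent `|m| + y ≤ (ρ+1)N + 2k` — GM14 Lemma 6.5's `D^k`);
  `HData.shift` (`d_k`), `HData.Hgt` (`H^k_n`), `HData.Yev` (the designated detour events);
* **`HData.hgt_le_process`** — `H^k_n ≤ X^k_n` for all `k ≤ K`, where `X` is the growth
  process of `GrowthProcessDomination` driven by the indicators of `Yev` from the initial
  range `initialRange ρ N` (GM14 (6.16)–(6.19), via `TrackExchangeGrowth.growth_dichotomy` and
  `GrowthProcess.le_process_of_forall_step`), and `HData.heights_le_of_process_le`: if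
  `X^K ≤ K` everywhere then every label of `γ^K` has height in `[0, K]`.

The probabilistic part (laws, the product bound for `Yev`, Lemma 6.7 and the final inequality
(6.10)) is in the sequel.

## References

* G. R. Grimmett, I. Manolescu, PTRF 159 (2014) 273–327, arXiv:1204.0505, §6.1 (`β̃`, regular
  and irregular blocks), §6.2 ((6.8), Lemmas 6.5, 6.6, displays (6.16)–(6.19)).
-/

noncomputable section

namespace Literature.Probability.Percolation

open LatticeModels StarTriangle Real MeasureTheory GrowthProcess

namespace TrackExchange

/-! ### Measurability of the pathwise maps (discrete σ-algebra on walks) -/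

/-- Walks are given the discrete σ-algebra (a local instance: walks never appear in the final
statements). [folklore] -/
@[reducible] def walkMeasurableSpace : MeasurableSpace (List SV) := ⊤

attribute [local instance] walkMeasurableSpace

/-- Every set of walks is measurable. [folklore] -/
theorem discreteMeasurableSpace_walk : DiscreteMeasurableSpace (List SV) := ⟨fun _ => MeasurableSpace.measurableSet_top⟩

attribute [local instance] discreteMeasurableSpace_walk

/-- Composition with a jointly measurable two-argument map, stated in applied form (this
avoids unfolding the map when unifying with `Function.uncurry`). [folklore] -/
theorem measurable_uncurry_comp {α β γ δ : Type*} [MeasurableSpace α] [MeasurableSpace β]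
    [MeasurableSpace γ] [MeasurableSpace δ] {f : α → β → γ} (hf : Measurable (Function.uncurry f))
    {g : δ → α} {h : δ → β} (hg : Measurable g) (hh : Measurable h) : Measurable fun x => f (g x) (h x) :=
  hf.comp (hg.prodMk hh)

namespace ExchangeData

variable (D : ExchangeData)

/-- The even-stage move on pairs is measurable. [folklore] -/
theorem measurable_sStepW (i₀ : ℤ) : Measurable (Function.uncurry (D.sStepW i₀)) := by
  have hω : Measurable fun x : WState × unitInterval => D.sStep i₀ x.1.1 x.2 :=
    measurable_uncurry_comp (D.measurable_sStep i₀) (measurable_fst.comp measurable_fst) measurable_snd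
  -- the new walk is a function of the old walk and of the three bits laid down
  have h1 : Measurable fun x : WState × unitInterval =>
      (x.1.2, readLocal (triEdge (D.evenTri i₀)) (D.sStep i₀ x.1.1 x.2)) :=
    (measurable_snd.comp measurable_fst).prodMk ((measurable_readLocal _).comp hω)
  have h2 := (measurable_of_countable fun y : List SV × (Fin 3 → Bool) =>
    contract (D.evenTri i₀) none y.2 y.1).comp h1
  exact hω.prodMk h2

/-- The odd-stage move on pairs is measurable. [folklore] -/
theorem measurable_tStepW (i₀ : ℤ) : Measurable (Function.uncurry (D.tStepW i₀)) := by
  have hω : Measurable fun x : WState × unitInterval => D.tStep i₀ x.1.1 x.2 :=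
    measurable_uncurry_comp (D.measurable_tStep i₀) (measurable_fst.comp measurable_fst) measurable_snd
  have h2 : Measurable fun x : WState × unitInterval => (subdivide (D.oddTri i₀) none x.1.2).map (D.swapMid (i₀ + 1)) :=
    (Measurable.of_discrete (f := fun W : List SV => (subdivide (D.oddTri i₀) none W).map (D.swapMid (i₀ + 1)))).comp
      (measurable_snd.comp measurable_fst)
  exact hω.prodMk h2

/-- Every move on pairs is measurable. [folklore] -/
theorem measurable_moveStepW (i₀ : ℤ) : Measurable (Function.uncurry (D.moveStepW i₀)) := by
  have h : Function.uncurry (D.moveStepW i₀) =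
      if Even (i₀ + D.j) then Function.uncurry (D.sStepW i₀) else Function.uncurry (D.tStepW i₀) := by
    funext x; unfold moveStepW; split_ifs <;> rfl
  rw [h]
  split_ifs
  · exact D.measurable_sStepW i₀
  · exact D.measurable_tStepW i₀

/-- Sliding on pairs is measurable. [folklore] -/
theorem measurable_slideW : Measurable fun x : WState × (Fin (2 * D.M) → unitInterval) => D.slideW x.1 x.2 :=
  RandomMapChain.measurable_run _ _ fun _ => D.measurable_moveStepW _

/-- The sweep on pairs is measurable. [folklore] -/
theorem measurable_sweepW : Measurable (Function.uncurry D.sweepW) := by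
  have hins : Measurable fun x : WState × (unitInterval × (Fin (2 * D.M) → unitInterval)) =>
      D.insertStep x.1.1 x.2.1 :=
    measurable_uncurry_comp D.measurable_insertStep (measurable_fst.comp measurable_fst) (measurable_fst.comp measurable_snd)
  have hsl : Measurable fun x : WState × (unitInterval × (Fin (2 * D.M) → unitInterval)) =>
      D.slideW (D.insertStep x.1.1 x.2.1, x.1.2) x.2.2 :=
    measurable_uncurry_comp (f := fun (y : WState) (u : Fin (2 * D.M) → unitInterval) => D.slideW y u)
      D.measurable_slideW (hins.prodMk (measurable_snd.comp measurable_fst)) (measurable_snd.comp measurable_snd)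
  exact (D.measurable_removeStep.comp (measurable_fst.comp hsl)).prodMk (measurable_snd.comp hsl)

end ExchangeData

namespace BlockData

variable (B : BlockData)

/-- Extension of a finite noise sequence by a default value. [folklore] -/
def ext (v : Fin B.N → B.Noise) (s : ℕ) : B.Noise := if h : s < B.N then v ⟨s, h⟩ else (0, fun _ => 0)

/-- `ext` on the range. [folklore] -/
theorem ext_apply (v : Fin B.N → B.Noise) (s : Fin B.N) : B.ext v s = v s := by
  unfold ext; rw [dif_pos s.2]

/-- Each coordinate of the extension is measurable. [folklore] -/
theorem measurable_ext (s : ℕ) : Measurable fun v : Fin B.N → B.Noise => B.ext v s := by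
  unfold ext
  split_ifs
  · exact measurable_pi_apply _
  · exact measurable_const

/-- The block on pairs, fed with a finite noise sequence, is measurable. [folklore] -/
theorem measurable_blockW : ∀ n : ℕ,
    Measurable fun x : ExchangeData.WState × (Fin B.N → B.Noise) => B.blockW (B.ext x.2) n x.1
  | 0 => by simp only [blockW_zero]; exact measurable_fst
  | n + 1 => by
    simp only [blockW_succ]
    exact measurable_uncurry_comp (B.D n).measurable_sweepW (measurable_blockW n)
      ((B.measurable_ext n).comp measurable_snd)

end BlockData

/-! ### The data of the horizontal transport -/

/-- **Data of the horizontal transport** (GM14 §6.1–6.2): the strip half-width `M`, column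
angles `α`, irregular row angles `β_0, β_1, …`, the regular angle `ξ`, the height `N` of the
regular block, and the number `K` of blocks `U_1, …, U_K` applied. [cite: GrimmettManolescu2014Isoradial, §6.1] -/
structure HData where
  /-- Half-width of the strip. -/
  M : ℕ
  /-- Transverse angles of the column tracks. -/
  α : ℤ → ℝ
  /-- Transverse angles of the irregular block. -/
  β : ℕ → ℝ
  /-- The regular angle. -/
  ξ : ℝ
  /-- Height of the regular block = number of sweeps per block. -/
  N : ℕ
  /-- Number of blocks. -/
  K : ℕ

namespace HData

variable (H : HData)

/-- **Row angles after `k` blocks**: levels `< k` carry `β_0, …, β_{k-1}`, levels `k, …, N+k-1`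
the regular angle, higher levels the rest of the irregular block (GM14: "`U_k` moves the track at
level `N+k-1` to level `k-1`, while raising the tracks at levels `k-1, …, N+k-2` by one level
each"). [cite: GrimmettManolescu2014Isoradial, §6.2] -/
def rowAngle (k : ℕ) (y : ℤ) : ℝ :=
  if y < k then H.β y.toNat else if y < H.N + k then H.ξ else H.β (y - H.N).toNat

/-- The canonical weights of the strip after `k` blocks (`k = 0`: GM14's `P_{α,β̃}`).
[cite: GrimmettManolescu2014Isoradial, §6.1] -/
def weights (k : ℕ) : Sym2 SV → unitInterval := canonicalWeight H.M fun i y => H.rowAngle k y - H.α i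

/-- The row angles of the `k`-th block with its descending track removed. [folklore] -/
def base (k : ℕ) (y : ℤ) : ℝ :=
  if y < k then H.β y.toNat else if y ≤ H.N + k then H.ξ else H.β (y - H.N).toNat

/-- **The `k`-th block** (`U_{k+1}` of GM14 (6.8), levels `N+k, …, k+1`). [cite: GrimmettManolescu2014Isoradial, §6.2 (6.8)] -/
def Bk (k : ℕ) : BlockData :=
  { M := H.M, α := H.α, base := H.base k, βk := H.β k, ξ := H.ξ, b := k + 1, N := H.N }

/-- Row angles below the descended tracks. [folklore] -/
theorem rowAngle_of_lt {k : ℕ} {y : ℤ} (h : y < k) : H.rowAngle k y = H.β y.toNat := by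
  unfold rowAngle; rw [if_pos h]

/-- Row angles in the regular block. [folklore] -/
theorem rowAngle_of_mid {k : ℕ} {y : ℤ} (h : (k : ℤ) ≤ y) (h' : y < H.N + k) : H.rowAngle k y = H.ξ := by
  unfold rowAngle; rw [if_neg (by omega), if_pos h']

/-- Row angles in the irregular block. [folklore] -/
theorem rowAngle_of_ge {k : ℕ} {y : ℤ} (h : (H.N : ℤ) + k ≤ y) : H.rowAngle k y = H.β (y - H.N).toNat := by
  unfold rowAngle; rw [if_neg (by omega), if_neg (by omega)]

/-- `base` below the block. [folklore] -/
theorem base_of_lt {k : ℕ} {y : ℤ} (h : y < k) : H.base k y = H.β y.toNat := by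
  unfold base; rw [if_pos h]

/-- `base` in the block. [folklore] -/
theorem base_of_mid {k : ℕ} {y : ℤ} (h : (k : ℤ) ≤ y) (h' : y ≤ H.N + k) : H.base k y = H.ξ := by
  unfold base; rw [if_neg (by omega), if_pos h']

/-- `base` above the block. [folklore] -/
theorem base_of_gt {k : ℕ} {y : ℤ} (h : (H.N : ℤ) + k < y) : H.base k y = H.β (y - H.N).toNat := by
  unfold base; rw [if_neg (by omega), if_neg (by omega)]

/-- The levels of the `k`-th block. [folklore] -/
theorem Bk_level (k s : ℕ) : (H.Bk k).level s = (H.N : ℤ) + k - s := by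
  simp only [BlockData.level, Bk]; ring

/-- The row angles of the `k`-th block. [folklore] -/
theorem Bk_rowβ (k s : ℕ) (y : ℤ) :
    (H.Bk k).rowβ s y = if y = (H.N : ℤ) + k - s then H.β k else H.base k y := by
  simp only [BlockData.rowβ, Bk_level]; rfl

/-- The initial row angles of the `k`-th block are the row angles after `k` blocks. [folklore] -/
theorem Bk_rowβ_zero (k : ℕ) : (H.Bk k).rowβ 0 = H.rowAngle k := by
  funext y
  rw [Bk_rowβ, Nat.cast_zero, sub_zero]
  by_cases h1 : y = (H.N : ℤ) + k
  · rw [if_pos h1, H.rowAngle_of_ge (by omega), h1, show ((H.N : ℤ) + k - H.N).toNat = k by omega]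
  rw [if_neg h1]
  rcases lt_or_ge y k with h2 | h2
  · rw [H.base_of_lt h2, H.rowAngle_of_lt h2]
  rcases lt_or_ge y ((H.N : ℤ) + k) with h3 | h3
  · rw [H.base_of_mid h2 h3.le, H.rowAngle_of_mid h2 h3]
  · rw [H.base_of_gt (by omega), H.rowAngle_of_ge h3]

/-- The final row angles of the `k`-th block are the row angles after `k + 1` blocks. [folklore] -/
theorem Bk_rowβ_N (k : ℕ) : (H.Bk k).rowβ H.N = H.rowAngle (k + 1) := by
  funext y
  rw [Bk_rowβ, show (H.N : ℤ) + k - (H.N : ℕ) = k by ring]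
  by_cases h1 : y = k
  · rw [if_pos h1, H.rowAngle_of_lt (by push_cast; omega), h1, Int.toNat_natCast]
  rw [if_neg h1]
  rcases lt_or_ge y k with h2 | h2
  · rw [H.base_of_lt h2, H.rowAngle_of_lt (by push_cast; omega)]
  rcases le_or_gt y ((H.N : ℤ) + k) with h3 | h3
  · rw [H.base_of_mid h2 h3, H.rowAngle_of_mid (by push_cast; omega) (by push_cast; omega)]
  · rw [H.base_of_gt h3, H.rowAngle_of_ge (by push_cast; omega)]

/-- **The `k`-th block starts from the weights after `k` blocks.** [cite: GrimmettManolescu2014Isoradial, §6.2] -/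
theorem Bk_initial (k : ℕ) : ((H.Bk k).D 0).initial = H.weights k := by
  show canonicalWeight H.M (fun i y => (H.Bk k).rowβ 0 y - H.α i) = _
  rw [Bk_rowβ_zero]; rfl

/-- **The `k`-th block ends with the weights after `k + 1` blocks.** [cite: GrimmettManolescu2014Isoradial, §6.2] -/
theorem Bk_final (k : ℕ) : ((H.Bk k).D H.N).initial = H.weights (k + 1) := by
  show canonicalWeight H.M (fun i y => (H.Bk k).rowβ H.N y - H.α i) = _
  rw [Bk_rowβ_N]; rfl

/-- When `β_k = ξ` the block would change nothing: the weights after `k` and `k + 1` blocks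
coincide. [cite: GrimmettManolescu2014Isoradial, §6.2] -/
theorem weights_succ_of_eq {k : ℕ} (h : H.β k = H.ξ) : H.weights (k + 1) = H.weights k := by
  have : H.rowAngle (k + 1) = H.rowAngle k := by
    funext y
    rcases lt_trichotomy y k with h1 | rfl | h1
    · rw [H.rowAngle_of_lt h1, H.rowAngle_of_lt (by push_cast; omega)]
    · rw [H.rowAngle_of_lt (by push_cast; omega), Int.toNat_natCast]
      unfold rowAngle
      rw [if_neg (lt_irrefl _)]
      split_ifs with h3
      · exact h
      · rw [show ((k : ℤ) - H.N).toNat = k by omega]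
    · rcases lt_trichotomy y ((H.N : ℤ) + k) with h2 | h2 | h2
      · rw [H.rowAngle_of_mid (by push_cast; omega) (by push_cast; omega), H.rowAngle_of_mid h1.le h2]
      · rw [H.rowAngle_of_mid (by push_cast; omega) (by push_cast; omega), H.rowAngle_of_ge h2.ge, h2,
          show (((H.N : ℤ) + k) - H.N).toNat = k by omega, h]
      · rw [H.rowAngle_of_ge (by push_cast; omega), H.rowAngle_of_ge h2.le]
  simp only [weights, this]

/-- **Hypotheses of the horizontal transport**: bounded angles `BAC(ε)` on the (nonempty) strip
for the regular angle and for every irregular angle, a nonempty regular block, and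
`0 < ε ≤ π/2`. [cite: GrimmettManolescu2014Isoradial, §6.2] -/
structure Valid (ε : ℝ) : Prop where
  /-- `0 < ε` -/
  ε_pos : 0 < ε
  /-- `ε ≤ π/2` -/
  ε_le : ε ≤ π / 2
  /-- the strip is nonempty -/
  M_pos : 0 < H.M
  /-- the regular block is nonempty -/
  N_pos : 0 < H.N
  /-- bounded angles for the regular tracks -/
  ξα : ∀ i : ℤ, -(H.M : ℤ) ≤ i → i < H.M → H.ξ - H.α i ∈ Set.Icc ε (π - ε)
  /-- bounded angles for the irregular tracks -/
  βα : ∀ (k : ℕ) (i : ℤ), -(H.M : ℤ) ≤ i → i < H.M → H.β k - H.α i ∈ Set.Icc ε (π - ε)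

variable {H}

/-- An active block (`β_k > ξ`) of valid data is a valid block. [cite: GrimmettManolescu2014Isoradial, §6.2] -/
theorem Bk_valid {ε : ℝ} (hH : H.Valid ε) {k : ℕ} (hk : H.ξ < H.β k) : (H.Bk k).Valid := by
  have hM : (0 : ℤ) < H.M := by exact_mod_cast hH.M_pos
  have h0ξ := hH.ξα 0 (by omega) hM
  have h0β := hH.βα k 0 (by omega) hM
  refine ⟨⟨?_, ?_⟩, fun i hi hi' => ?_, fun i hi hi' => ?_, fun y hy hy' => ?_, ?_⟩
  · show 0 < H.β k - H.ξ; linarith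
  · show H.β k - H.ξ < π; linarith [h0ξ.1, h0β.2, hH.ε_pos]
  · have h := hH.ξα i hi hi'
    exact ⟨by show 0 < H.ξ - H.α i; linarith [h.1, hH.ε_pos], by show H.ξ - H.α i < π; linarith [h.2, hH.ε_pos]⟩
  · have h := hH.βα k i hi hi'
    exact ⟨by show 0 < H.β k - H.α i; linarith [h.1, hH.ε_pos], by show H.β k - H.α i < π; linarith [h.2, hH.ε_pos]⟩
  · change (k : ℤ) + 1 - 1 ≤ y at hy
    change y ≤ (k : ℤ) + 1 + H.N - 1 at hy'
    exact H.base_of_mid (by omega) (by omega)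
  · show (1 : ℤ) ≤ k + 1; omega

/-- A block with `β_k < ξ` of valid data is a valid right-to-left block. [cite: GrimmettManolescu2014Isoradial, §6.2] -/
theorem Bk_validRL {ε : ℝ} (hH : H.Valid ε) {k : ℕ} (hk : H.β k < H.ξ) : (H.Bk k).ValidRL := by
  refine ⟨by simpa [Bk] using hk, by simpa [Bk] using hH.M_pos, fun i hi hi' => ?_, fun i hi hi' => ?_,
    fun y hy hy' => ?_, by show (1 : ℤ) ≤ k + 1; omega⟩
  · have h := hH.ξα i hi hi'
    exact ⟨by show 0 < H.ξ - H.α i; linarith [h.1, hH.ε_pos], by show H.ξ - H.α i < π; linarith [h.2, hH.ε_pos]⟩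
  · have h := hH.βα k i hi hi'
    exact ⟨by show 0 < H.β k - H.α i; linarith [h.1, hH.ε_pos], by show H.β k - H.α i < π; linarith [h.2, hH.ε_pos]⟩
  · change (k : ℤ) + 1 - 1 ≤ y at hy
    change y ≤ (k : ℤ) + 1 + H.N - 1 at hy'
    exact H.base_of_mid (by omega) (by omega)

/-! ### The process of blocks on (configuration, walk) pairs -/

variable (H)

/-- The randomness of one sweep. [folklore] -/
abbrev Noise : Type := unitInterval × (Fin (2 * H.M) → unitInterval)

/-- The randomness of one block: `N` sweeps. [folklore] -/
abbrev BNoise : Type := Fin H.N → H.Noise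

/-- **One block `U_{k+1}` on a configuration and a walk**: from left to right when `β_k > ξ`,
from right to left when `β_k < ξ`, skipped when `β_k = ξ` ("If `β_k = ξ`, no track-exchange
takes place"). [cite: GrimmettManolescu2014Isoradial, §6.2] -/
def blockStep (k : ℕ) (x : ExchangeData.WState) (v : H.BNoise) : ExchangeData.WState :=
  if H.ξ < H.β k then (H.Bk k).blockW ((H.Bk k).ext v) H.N x
  else if H.β k < H.ξ then (H.Bk k).blockWRL ((H.Bk k).ext v) H.N x else x

/-- The reflection of pairs is measurable (discrete σ-algebra on walks). [folklore] -/
theorem measurable_reflW : Measurable reflW :=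
  (measurable_reflCfg.comp measurable_fst).prodMk
    ((Measurable.of_discrete (f := fun W : List SV => W.map reflL)).comp measurable_snd)

/-- The block on pairs is measurable (discrete σ-algebra on walks). [folklore] -/
theorem measurable_blockStep (k : ℕ) : Measurable (Function.uncurry (H.blockStep k)) := by
  by_cases h1 : H.ξ < H.β k
  · have h : Function.uncurry (H.blockStep k) =
        fun x : ExchangeData.WState × H.BNoise => (H.Bk k).blockW ((H.Bk k).ext x.2) H.N x.1 := by
      funext ⟨a, b⟩; show H.blockStep k a b = _; unfold blockStep; rw [if_pos h1]
    rw [h]; exact (H.Bk k).measurable_blockW H.N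
  · by_cases h2 : H.β k < H.ξ
    · have h : Function.uncurry (H.blockStep k) =
          fun x : ExchangeData.WState × H.BNoise => reflW ((H.Bk k).refl.blockW ((H.Bk k).ext x.2) H.N (reflW x.1)) := by
        funext ⟨a, b⟩; show H.blockStep k a b = _; unfold blockStep BlockData.blockWRL; rw [if_neg h1, if_pos h2]
      rw [h]
      exact measurable_reflW.comp (((H.Bk k).refl.measurable_blockW H.N).comp
        ((measurable_reflW.comp measurable_fst).prodMk measurable_snd))
    · have h : Function.uncurry (H.blockStep k) = Prod.fst := by
        funext ⟨a, b⟩; show H.blockStep k a b = _; unfold blockStep; rw [if_neg h1, if_neg h2]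
      rw [h]; exact measurable_fst

/-- **The states `(ω^k, γ^k)` after `k` blocks** (`ω^k = U_k ∘ ⋯ ∘ U_1(ω^0)`,
`γ^k = U_k ∘ ⋯ ∘ U_1(γ^0)`), for the noise `v 0, v 1, …`. [cite: GrimmettManolescu2014Isoradial, §6.2] -/
def traj (x₀ : ExchangeData.WState) (v : ℕ → H.BNoise) : ℕ → ExchangeData.WState
  | 0 => x₀
  | k + 1 => H.blockStep k (traj x₀ v k) (v k)

/-- No block applied. [folklore] -/
@[simp] theorem traj_zero (x₀ : ExchangeData.WState) (v : ℕ → H.BNoise) : H.traj x₀ v 0 = x₀ := rfl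

/-- One more block. [folklore] -/
theorem traj_succ (x₀ : ExchangeData.WState) (v : ℕ → H.BNoise) (k : ℕ) :
    H.traj x₀ v (k + 1) = H.blockStep k (H.traj x₀ v k) (v k) := rfl

/-- **The lateral shift `d_k`** ("`d_{k+1} = d_k + 1` if `β_k > ξ`, `d_k` if `β_k = ξ`,
`d_k - 1` if `β_k < ξ`"). [cite: GrimmettManolescu2014Isoradial, §6.2] -/
def shift : ℕ → ℤ
  | 0 => 0
  | k + 1 => shift k + if H.ξ < H.β k then 1 else if H.β k < H.ξ then -1 else 0

/-- **The shifted column heights `H^k_n = h(γ^k ∩ col_{n + d_k})`.** [cite: GrimmettManolescu2014Isoradial, §6.2] -/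
def hgt (x₀ : ExchangeData.WState) (v : ℕ → H.BNoise) (k : ℕ) (n : ℤ) : WithBot ℤ :=
  colmax (H.traj x₀ v k).2 (n + H.shift k)

/-- **The designated detour event `Y^k_n = 1`** (dominating GM14's Bernoulli variable): block
`k` is active and the designated detour event of the shifted column `n + d_k` occurs for the
block started from `γ^k` — for a right-to-left block, that of the reflected block at the
reflected column. [cite: GrimmettManolescu2014Isoradial, §6.2 Lemma 6.6] -/
def Yev (x₀ : ExchangeData.WState) (v : ℕ → H.BNoise) (k : ℕ) (n : ℤ) : Prop :=
  (H.ξ < H.β k ∧ (H.Bk k).Ydet (H.traj x₀ v k).2 ((H.Bk k).ext (v k)) (n + H.shift k)) ∨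
  (H.β k < H.ξ ∧ (H.Bk k).refl.Ydet ((H.traj x₀ v k).2.map reflL) ((H.Bk k).ext (v k)) (-(n + H.shift k)))

open Classical in
/-- The indicator of the designated detour event. [folklore] -/
def Yb (x₀ : ExchangeData.WState) (v : ℕ → H.BNoise) (k : ℕ) (n : ℤ) : Bool := decide (H.Yev x₀ v k n)

/-- **The invariant of the process** after `k` blocks (GM14 Lemma 6.5: "`γ^k` is an open path
contained in `D^k`", `D^k = {|x| ≤ (ρ+1)N + 2k - y, 0 ≤ y}`; here `C₀ = (ρ+1)N`).
[cite: GrimmettManolescu2014Isoradial, §6.2 Lemma 6.5] -/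
structure ProcInv (P₀ P₁ : SV) (C₀ : ℤ) (k : ℕ) (x : ExchangeData.WState) : Prop where
  /-- clean for the current weights -/
  clean : Clean (H.weights k) x.1
  /-- the walk is open -/
  walk : IsWalk x.1 x.2
  /-- first endpoint -/
  head : x.2.head? = some P₀
  /-- last endpoint -/
  last : x.2.getLast? = some P₁
  /-- the walk avoids `⋆` -/
  none_not_mem : none ∉ x.2
  /-- labels are primal -/
  parity : ∀ m y, some (m, y) ∈ x.2 → Even (m + y)
  /-- heights are nonnegative -/
  nonneg : ∀ m y, some (m, y) ∈ x.2 → 0 ≤ y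
  /-- the tent `D^k` -/
  tent : ∀ m y, some (m, y) ∈ x.2 → |m| + y ≤ C₀ + 2 * k

variable {H}

/-- The block invariant delivered by an active block started in the process invariant. [folklore] -/
theorem blockInv_of_procInv {ε : ℝ} (hH : H.Valid ε) {P₀ P₁ : SV} (hP₀ : ∃ x₀ : ℤ, P₀ = some (x₀, 0))
    (hP₁ : ∃ x₁ : ℤ, P₁ = some (x₁, 0)) {C₀ : ℤ} {k : ℕ} (hM : C₀ + 2 * k + 3 ≤ H.M) (hk : H.ξ < H.β k)
    {x : ExchangeData.WState} (hx : H.ProcInv P₀ P₁ C₀ k x) (v : H.BNoise) :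
    (H.Bk k).BlockInv x.2 P₀ P₁ ((H.Bk k).ext v) H.N ((H.Bk k).blockW ((H.Bk k).ext v) H.N x) := by
  have hC : Clean ((H.Bk k).D 0).initial x.1 := by rw [Bk_initial]; exact hx.clean
  have h := BlockData.blockW_spec (Bk_valid hH hk) ((H.Bk k).ext v) hP₀ hP₁ hx.parity
    (fun m y hm => ⟨hx.tent m y hm, hx.nonneg m y hm⟩) (by show C₀ + 2 * k + 3 ≤ (H.M : ℤ); exact hM)
    (by show (0 : ℤ) ≤ k + 1; omega) hC hx.walk hx.head hx.last hx.none_not_mem H.N le_rfl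
  exact h

/-- **One block preserves the process invariant** (GM14 Lemma 6.5). [cite: GrimmettManolescu2014Isoradial, §6.2 Lemma 6.5] -/
theorem ProcInv.succ {ε : ℝ} (hH : H.Valid ε) {P₀ P₁ : SV} (hP₀ : ∃ x₀ : ℤ, P₀ = some (x₀, 0))
    (hP₁ : ∃ x₁ : ℤ, P₁ = some (x₁, 0)) {C₀ : ℤ} {k : ℕ} (hM : C₀ + 2 * k + 3 ≤ H.M)
    {x : ExchangeData.WState} (hx : H.ProcInv P₀ P₁ C₀ k x) (v : H.BNoise) :
    H.ProcInv P₀ P₁ C₀ (k + 1) (H.blockStep k x v) := by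
  unfold blockStep
  by_cases h1 : H.ξ < H.β k
  · rw [if_pos h1]
    have hinv := blockInv_of_procInv hH hP₀ hP₁ hM h1 hx v
    have hlev : (H.Bk k).level H.N = k := by rw [Bk_level]; ring
    refine ⟨by rw [← Bk_final]; exact hinv.clean, hinv.walk, hinv.head, hinv.last, hinv.none_not_mem, hinv.parity,
      hinv.nonneg, fun m y hm => ?_⟩
    have hb := hinv.bound m y hm
    rw [hlev] at hb
    have := hb.add_abs_le (C := C₀ + 2 * k) fun m h hm => ⟨hx.tent m h hm, hx.nonneg m h hm⟩
    push_cast; omega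
  rw [if_neg h1]
  by_cases h2 : H.β k < H.ξ
  · rw [if_pos h2]
    have hC : Clean ((H.Bk k).D 0).initial x.1 := by rw [Bk_initial]; exact hx.clean
    obtain ⟨hc, hw, hh, hl, hn, hpar, hnn, htent⟩ := BlockData.blockWRL_conclusions (Bk_validRL hH h2) ((H.Bk k).ext v)
      hP₀ hP₁ hx.parity (C := C₀ + 2 * k) (fun m y hm => ⟨hx.tent m y hm, hx.nonneg m y hm⟩)
      (by show C₀ + 2 * k + 3 ≤ (H.M : ℤ); exact hM) (by show (0 : ℤ) ≤ k + 1; omega)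
      hC hx.walk hx.head hx.last hx.none_not_mem
    refine ⟨by rw [← Bk_final]; exact hc, hw, hh, hl, hn, hpar, hnn, fun m y hm => ?_⟩
    have := htent m y hm; push_cast; omega
  · rw [if_neg h2]
    have heq : H.β k = H.ξ := le_antisymm (not_lt.1 h1) (not_lt.1 h2)
    refine ⟨by rw [H.weights_succ_of_eq heq]; exact hx.clean, hx.walk, hx.head, hx.last, hx.none_not_mem, hx.parity,
      hx.nonneg, fun m y hm => ?_⟩
    have := hx.tent m y hm; push_cast; omega

/-- **The process invariant holds throughout** (for `k ≤ K` when `C₀ + 2K + 3 ≤ M`).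
[cite: GrimmettManolescu2014Isoradial, §6.2 Lemma 6.5] -/
theorem procInv_traj {ε : ℝ} (hH : H.Valid ε) {P₀ P₁ : SV} (hP₀ : ∃ x₀ : ℤ, P₀ = some (x₀, 0))
    (hP₁ : ∃ x₁ : ℤ, P₁ = some (x₁, 0)) {C₀ : ℤ} (hM : C₀ + 2 * H.K + 3 ≤ H.M)
    {x₀ : ExchangeData.WState} (h0 : H.ProcInv P₀ P₁ C₀ 0 x₀) (v : ℕ → H.BNoise) :
    ∀ k ≤ H.K, H.ProcInv P₀ P₁ C₀ k (H.traj x₀ v k) := by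
  intro k
  induction k with
  | zero => exact fun _ => h0
  | succ k ih =>
    intro hk
    rw [traj_succ]
    exact (ih (by omega)).succ hH hP₀ hP₁ (by omega) (v k)

/-- **Lemma 6.6, one step** (`H^{k+1}_n ≤ max{C(H^k)_n, H^k_n + Y^k_n}` with the covering
written as mountains): from the process invariant at block `k`.
[cite: GrimmettManolescu2014Isoradial, §6.2 Lemma 6.6] -/
theorem hgt_succ_le {ε : ℝ} (hH : H.Valid ε) {P₀ P₁ : SV} (hP₀ : ∃ x₀ : ℤ, P₀ = some (x₀, 0))
    (hP₁ : ∃ x₁ : ℤ, P₁ = some (x₁, 0)) {C₀ : ℤ} {k : ℕ} (hM : C₀ + 2 * k + 3 ≤ H.M)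
    {x₀ : ExchangeData.WState} {v : ℕ → H.BNoise} (hx : H.ProcInv P₀ P₁ C₀ k (H.traj x₀ v k)) (n : ℤ) :
    (∃ l, H.hgt x₀ v (k + 1) n ≤ mountain l (H.hgt x₀ v k l) n) ∨
      H.hgt x₀ v (k + 1) n ≤ H.hgt x₀ v k n + (((H.Yb x₀ v k n).toNat : ℤ) : WithBot ℤ) := by
  unfold hgt
  rw [traj_succ]
  unfold blockStep
  simp only [shift]
  by_cases h1 : H.ξ < H.β k
  · rw [if_pos h1, if_pos h1]
    have hinv := blockInv_of_procInv hH hP₀ hP₁ hM h1 hx (v k)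
    rcases BlockData.growth_dichotomy hx.parity hinv (n + H.shift k) (H.shift k) with ⟨l, hl⟩ | ⟨hY, hle⟩
    · left
      refine ⟨l, ?_⟩
      rw [← add_assoc]
      rwa [add_sub_cancel_right] at hl
    · right
      have hYb : H.Yb x₀ v k n = true := by
        classical
        unfold Yb Yev
        simp only [decide_eq_true_eq]
        exact Or.inl ⟨h1, hY⟩
      rw [hYb, ← add_assoc]
      simpa using hle
  rw [if_neg h1, if_neg h1]
  by_cases h2 : H.β k < H.ξ
  · rw [if_pos h2, if_pos h2]
    -- the right-to-left block: the reflected block invariant and the reflected dichotomy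
    have hx' := hx
    obtain ⟨a, ha⟩ := hP₀
    obtain ⟨b, hb⟩ := hP₁
    have hC : Clean ((H.Bk k).D 0).initial (H.traj x₀ v k).1 := by rw [Bk_initial]; exact hx.clean
    have hinv := BlockData.blockWRL_spec (Bk_validRL hH h2) ((H.Bk k).ext (v k)) ⟨a, ha⟩ ⟨b, hb⟩ hx.parity
      (C := C₀ + 2 * k) (fun m y hm => ⟨hx.tent m y hm, hx.nonneg m y hm⟩)
      (by show C₀ + 2 * k + 3 ≤ (H.M : ℤ); exact hM) (by show (0 : ℤ) ≤ k + 1; omega)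
      hC hx.walk hx.head hx.last hx.none_not_mem H.N le_rfl
    have hx2 : ((H.Bk k).blockWRL ((H.Bk k).ext (v k)) H.N (H.traj x₀ v k)).2 =
        ((H.Bk k).refl.blockW ((H.Bk k).ext (v k)) H.N (reflW (H.traj x₀ v k))).2.map reflL := rfl
    have htr : (H.traj x₀ v k) = ((H.traj x₀ v k).1, (H.traj x₀ v k).2) := rfl
    rw [htr] at hinv
    rcases BlockData.growth_dichotomyRL hx.parity hinv (n + H.shift k) (H.shift k) with ⟨l, hl⟩ | ⟨hY, hle⟩
    · left
      refine ⟨l, ?_⟩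
      rw [hx2, show n + (H.shift k + -1) = n + H.shift k - 1 by ring]
      rwa [add_sub_cancel_right] at hl
    · right
      have hYb : H.Yb x₀ v k n = true := by
        classical
        unfold Yb Yev
        simp only [decide_eq_true_eq]
        exact Or.inr ⟨h2, hY⟩
      rw [hYb, hx2, show n + (H.shift k + -1) = n + H.shift k - 1 by ring]
      simpa using hle
  · -- a skipped block: nothing moves
    rw [if_neg h2, if_neg h2]
    left
    refine ⟨n, ?_⟩
    rw [add_zero]
    unfold mountain; rw [if_pos rfl]

/-- **`H^k ≤ X^k` for all `k ≤ K`** (GM14 (6.17)–(6.19): "We show first, by induction, that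
`X^k ≥ H^k` for all `k`"), where `X` is the growth process driven by the indicators `Yb` from
the initial range `initialRange ρ N`, provided `H^0 ≤ X^0`. [cite: GrimmettManolescu2014Isoradial, §6.2 (6.17)–(6.19)] -/
theorem hgt_le_process {ε : ℝ} (hH : H.Valid ε) {P₀ P₁ : SV} (hP₀ : ∃ x₀ : ℤ, P₀ = some (x₀, 0))
    (hP₁ : ∃ x₁ : ℤ, P₁ = some (x₁, 0)) {C₀ : ℤ} (hM : C₀ + 2 * H.K + 3 ≤ H.M)
    {x₀ : ExchangeData.WState} (h0 : H.ProcInv P₀ P₁ C₀ 0 x₀) (v : ℕ → H.BNoise) (ρ N : ℕ)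
    (hinit : ∀ n, H.hgt x₀ v 0 n ≤ (initialRange ρ N n : WithBot ℤ)) :
    ∀ k ≤ H.K, ∀ n, H.hgt x₀ v k n ≤ (process (H.Yb x₀ v) (initialRange ρ N) k n : WithBot ℤ) :=
  le_process_of_forall_step (isRegular_initialRange ρ N) hinit fun k hk n =>
    hgt_succ_le hH hP₀ hP₁ (by omega) (procInv_traj hH hP₀ hP₁ hM h0 v k hk.le) n

/-- **If the growth process stays below `K`, the final walk has heights in `[0, K]`.**
[cite: GrimmettManolescu2014Isoradial, §6.2 (6.14)] -/
theorem heights_le_of_process_le {ε : ℝ} (hH : H.Valid ε) {P₀ P₁ : SV} (hP₀ : ∃ x₀ : ℤ, P₀ = some (x₀, 0))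
    (hP₁ : ∃ x₁ : ℤ, P₁ = some (x₁, 0)) {C₀ : ℤ} (hM : C₀ + 2 * H.K + 3 ≤ H.M)
    {x₀ : ExchangeData.WState} (h0 : H.ProcInv P₀ P₁ C₀ 0 x₀) (v : ℕ → H.BNoise) (ρ N : ℕ)
    (hinit : ∀ n, H.hgt x₀ v 0 n ≤ (initialRange ρ N n : WithBot ℤ))
    (hX : ∀ n, process (H.Yb x₀ v) (initialRange ρ N) H.K n ≤ H.K) :
    ∀ m y, some (m, y) ∈ (H.traj x₀ v H.K).2 → 0 ≤ y ∧ y ≤ H.K := by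
  intro m y hm
  refine ⟨(procInv_traj hH hP₀ hP₁ hM h0 v H.K le_rfl).nonneg m y hm, ?_⟩
  have h1 := hgt_le_process hH hP₀ hP₁ hM h0 v ρ N hinit H.K le_rfl (m - H.shift H.K)
  unfold hgt at h1
  rw [sub_add_cancel] at h1
  have h2 := (le_colmax hm).trans (h1.trans (WithBot.coe_le_coe.2 (hX _)))
  exact_mod_cast h2

end HData

end TrackExchange

end Literature.Probability.Percolation
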